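import Summits.QuantumFields.YangMills.Theorems.BalabanUVNodesN13UVRowRFreeAtLiveSelectorRecord13

/-!
# BalabanUVNodes ∕ N13 — LOCATED: AT A LIVE-SELECTOR PARAMETER THE UPPER HALF OF (UV₁₃) WITH LEVEL-DEPENDENT CONSTANTS IS VERSION ROWS × BOOKKEEPING —
# `slot_k ≤ (∏_{j<k} D_j)·S₀` and `ρ_k ≤ |histories_k|·(∏_{j<k} D_j)·S₀` from EVERYWHERE bounds `avgDensity_j ≤ D_j` on the marginal-density versions, the level-0
# supremum `ρ₀ ≤ S₀`, `|w| ≤ 1` (ζ-size law) and `0 ≤ χ ≤ 1`; so what [III] Cor. 3 ∕ [B16] (0.1) ADD to this at such parameters is exactly the k-UNIFORMITY of the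
# exponent (`E₊ = e₊(g_k)` independent of the number `k` of completed steps) — the renormalization content — and nothing an induction on def-T's (†) can see

Cell `pub-ymgap` (HUMAN RULING D-0062 Track A ∕ D-0149 width), WIDTH SEAT `pub-ymgap-dag-n13-w1` (gen 4, CLAIM-4), key K1⁷ `StabilityBAtRecordR13SepCoPH` =
stmt-QuantumFields-20542 (`--kind proof --supports … --as helper`; count-neutral; LOCATED reading).  [III] = [Balaban1988Convergent], [IV] = [Balaban1989LargeFieldI],
[B16] = [Balaban1989LargeFieldII].

WHY.  This seat's p607786 showed `slot_{k+1} ≤ slotT_{k+1}` at every live-selector parameter (all K0∕K1 witnesses) and `slotT_{k+1}(s′)(V′) = avgDensity_k(V′)·∫(w·χ_k·slot_k)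
(init s′) ∂avgKernel_k(V′)` (def-T's (†)).  The kernel `avgKernel_k(V′)` is a probability measure (`Measure.condKernel`, Markov); `|w| ≤ 1` under the DISPLAYED ζ-size law
(def-T's `abs_wOfRecord_le_one`), `0 ≤ χ_k ≤ 1`, `slot_k ≥ 0` under the two ζ-laws.  Hence ONE STEP (§1): if `avgDensity_k ≤ D` at EVERY `V′` and `slot_k ≤ S` everywhere then
`slotT_{k+1} ≤ D·S` and `slot_{k+1} ≤ D·S` everywhere; by INDUCTION (§2) `slot_k ≤ (∏_{j<k} D_j)·S₀` from the level-0 supremum `S₀`; and (§3) `ρ_k(V) ≤ |Seq_k|·(∏_{j<k} D_j)·S₀`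
— the UPPER inequality of (UV₁₃) at level `k` with a constant depending on the NUMBER `k` OF COMPLETED STEPS (through the versions' bounds and the history count), for
every field, with NO analytic input.  READING (for plan ∕ dag-lead; count-neutral): (i) the inputs `D_j` are EVERYWHERE bounds on Mathlib's chosen `rnDeriv` versions — the
(H-h) rows (dag-n23-b INBOX l.11265), decidable only in a version-free currency; (ii) granting them, an upper bound with `k`-DEPENDENT exponent is bookkeeping, so the content of
print's `E₊ = e₊(g_k)` «independent of η and T» ([III] Cor. 3 p.264; [B16] (0.1) p.356 «independent of k, T_η, U_k») at these parameters is precisely UNIFORMITY IN `k` — cf. this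
seat's g3 reading (R1) (`…N13UVRowDepthIndexedAtRecord13`: under NODE O's `b > 0` the REMAINING depth `K − k` is bounded by `g_k⁻²∕b`, the ELAPSED depth `k` is not).

CONTENTS (theorems only; 0 `def`).  §1 `integral_avgKernel_le_of_abs_le` · `slotsTOfRecord_succ_le_mul_of_avgDensity_le_of_slots_le` · `slotsOfRecord₁₃_succ_le_mul_of_avgDensity_le_of_slots_le_of_liveSel`;
§2 ★ `slotsOfRecord₁₃_le_prod_mul_of_avgDensity_le_of_liveSel`; §3 ★★ `densOfRecord₁₃_le_card_mul_prod_mul_of_avgDensity_le_of_liveSel`.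

HONEST FRAMING.  Count-neutral structural bookkeeping; the version bounds `D_j`, the level-0 supremum `S₀` and the ζ-laws are DISPLAYED hypotheses (nothing of Bałaban's asserted);
the typed (UV₁₃) row (exponent `e₊(g_k)·|T₁^{(k)}|`, uniform in `k`) is NOT supplied; N13 NOT discharged; K0⁷∕K1⁷ NOT closed; no stub closed; counts unmoved (typed 28∕28 ·
discharged 5∕27, A 5∕28); one finite `𝕋⁴_{L^K}` programme at fixed `ε = L^{−K}`; route R4 closes the CONDITIONAL finite-𝕋⁴ rung `BalabanLadder.UV` only — the Yang–Mills mass gap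
(Clay) is NOT proved by any of this.  No `sorry`, `def`, `instance`, `notation`; standard axioms.
-/

noncomputable section

open scoped BigOperators Matrix.Norms.L2Operator

namespace Summit.QuantumFields.YangMills.BalabanUVNodes.N13UVUpperOfVersionBoundsAtLiveSelector

open MeasureTheory
open Literature.MathematicalPhysics.QuantumFieldTheory.Balaban1983to89
open Literature.MathematicalPhysics.QuantumFieldTheory.Balaban1983to89.T4Continuum (T4Family)
open Literature.MathematicalPhysics.QuantumFieldTheory.Balaban1983to89.Node00
open B14.Eq218Concrete
open T4AveragingDisintegration (avgDensity avgKernel)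
open Summit.QuantumFields.YangMills.BalabanUVNodes.N13UVRowRFreeAtLiveSelectorRecord13
  (slotsOfRecord₁₃_succ_le_slotsT_of_liveSel wOfRecord₉_nonneg)
open Summit.QuantumFields.YangMills.Theorems.N21StepWeightsPositivity (zetaOfRecord_nonneg)

variable {F : T4Family} {N : ℕ} [NeZero N]

/-! ## §1 ONE STEP: `slotT_{k+1} ≤ D·S` and `slot_{k+1} ≤ D·S` from `avgDensity_k ≤ D`, `slot_k ≤ S`, `|w| ≤ 1`, `0 ≤ χ_k ≤ 1` -/

section OneStep

variable (θ : Stage13Params F N) (P : B12.RunParams) (k : ℕ)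

/-- **An integral against the averaging KERNEL of record is bounded by any everywhere bound of the integrand's absolute value** (the conditional law `avgKernel` is a
probability measure — `Measure.condKernel` is Markov; Mathlib `norm_integral_le_of_norm_le_const`). [folklore] -/
theorem integral_avgKernel_le_of_abs_le {f : GaugeField (F.P P.K) k (SU N) → ℝ} {C : ℝ} (hf : ∀ U, |f U| ≤ C) (V' : GaugeField (F.P P.K) (k + 1) (SU N)) :
    ∫ U, f U ∂(avgKernel (avOfRecord F N P.K k).avg V') ≤ C := by
  have h := norm_integral_le_of_norm_le_const (μ := avgKernel (avOfRecord F N P.K k).avg V') (f := f) (C := C)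
    (Filter.Eventually.of_forall fun U => by rw [Real.norm_eq_abs]; exact hf U)
  rw [probReal_univ, mul_one, Real.norm_eq_abs] at h
  exact (le_abs_self _).trans h

/-- **ONE STEP ON THE 𝐓-IMAGE**: `avgDensity_k ≤ D` at every coarse field, `0 ≤ slot_k ≤ S` everywhere, the ζ-size law (`|w| ≤ 1`) ⇒ `slotT_{k+1}(s′)(V′) ≤ D·S` at every `V′`
(def-T's (†); `0 ≤ χ_k ≤ 1`). [cite: Balaban1988Convergent, (3.1) p.264, (3.2)–(3.3) p.265, (3.24)–(3.25) p.270 (bookkeeping over def-T's definition)] -/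
theorem slotsTOfRecord_succ_le_mul_of_avgDensity_le_of_slots_le (hζa : IsZetaAbsLeOne F N θ.ν θ.τ9.M θ.ζ) {D S : ℝ}
    (hD : ∀ V' : GaugeField (F.P P.K) (k + 1) (SU N), (avgDensity (avOfRecord F N P.K k).avg V' : ℝ) ≤ D) (hS0 : 0 ≤ S)
    (hS : ∀ (s : SeqOfRecord F θ.ν θ.τ9.M (gOfRecord₁₃ F N θ P) P.K k) (U : GaugeField (F.P P.K) k (SU N)),
      0 ≤ slotsOfRecord F N θ.ν θ.τ9 (EOfRecord₁₃ F N θ) (wOfRecord₉ F N θ.toStage9Params) θ.ppSel P (gOfRecord₁₃ F N θ P) k s U ∧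
        slotsOfRecord F N θ.ν θ.τ9 (EOfRecord₁₃ F N θ) (wOfRecord₉ F N θ.toStage9Params) θ.ppSel P (gOfRecord₁₃ F N θ P) k s U ≤ S)
    (s' : SeqOfRecord F θ.ν θ.τ9.M (gOfRecord₁₃ F N θ P) P.K (k + 1)) (V' : GaugeField (F.P P.K) (k + 1) (SU N)) :
    slotsTOfRecord F N θ.ν θ.τ9 (EOfRecord₁₃ F N θ) (wOfRecord₉ F N θ.toStage9Params) θ.ppSel P (gOfRecord₁₃ F N θ P) (k + 1) s' V' ≤ D * S := by
  rw [slotsTOfRecord_succ]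
  unfold tstepOfRecord
  rw [texpASucc_apply]
  have hI : ∫ U, wOfRecord₉ F N θ.toStage9Params P (gOfRecord₁₃ F N θ P) k s' U V' *
        (chiSeqOfRecord F N θ.ν θ.τ9.M (gOfRecord₁₃ F N θ P) P.K k s'.init U *
          slotsOfRecord F N θ.ν θ.τ9 (EOfRecord₁₃ F N θ) (wOfRecord₉ F N θ.toStage9Params) θ.ppSel P (gOfRecord₁₃ F N θ P) k s'.init U)
        ∂(avgKernel (avOfRecord F N P.K k).avg V') ≤ S := by
    refine integral_avgKernel_le_of_abs_le P k (fun U => ?_) V'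
    have hw : |wOfRecord₉ F N θ.toStage9Params P (gOfRecord₁₃ F N θ P) k s' U V'| ≤ 1 :=
      abs_wOfRecord_le_one F N θ.ν θ.τ9.M θ.A₁ hζa P (gOfRecord₁₃ F N θ P) k s' U V'
    have hχ0 : 0 ≤ chiSeqOfRecord F N θ.ν θ.τ9.M (gOfRecord₁₃ F N θ P) P.K k s'.init U := chiSeqOfRecord_nonneg F N θ.ν θ.τ9.M _ P.K k _ U
    have hχ1 : chiSeqOfRecord F N θ.ν θ.τ9.M (gOfRecord₁₃ F N θ P) P.K k s'.init U ≤ 1 :=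
      (abs_le.mp (abs_chiSeqOfRecord_le_one F N θ.ν θ.τ9.M (gOfRecord₁₃ F N θ P) P.K k s'.init U)).2
    obtain ⟨hs0, hsS⟩ := hS s'.init U
    rw [abs_mul, abs_of_nonneg (mul_nonneg hχ0 hs0)]
    calc |wOfRecord₉ F N θ.toStage9Params P (gOfRecord₁₃ F N θ P) k s' U V'| *
          (chiSeqOfRecord F N θ.ν θ.τ9.M (gOfRecord₁₃ F N θ P) P.K k s'.init U *
            slotsOfRecord F N θ.ν θ.τ9 (EOfRecord₁₃ F N θ) (wOfRecord₉ F N θ.toStage9Params) θ.ppSel P (gOfRecord₁₃ F N θ P) k s'.init U)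
        ≤ 1 * (1 * S) := mul_le_mul hw (mul_le_mul hχ1 hsS hs0 zero_le_one) (mul_nonneg hχ0 hs0) zero_le_one
      _ = S := by ring
  have hd0 : 0 ≤ (avgDensity (avOfRecord F N P.K k).avg V' : ℝ) := NNReal.coe_nonneg _
  exact (mul_le_mul_of_nonneg_left hI hd0).trans (mul_le_mul_of_nonneg_right (hD V') hS0)

/-- **ONE STEP ON THE POST-𝐑 FAMILY at a live-selector parameter**: the same hypotheses ⇒ `0 ≤ slot_{k+1}(s′)(V′) ≤ D·S` (p607786: `slot_{k+1} ≤ slotT_{k+1}`; K0's `slotsOfRecord_nonneg`).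
[cite: Balaban1989LargeFieldI, (0.3) p.176 and p.177 (i)–(ii); Balaban1988Convergent, (3.24)–(3.25) p.270 (bookkeeping)] -/
theorem slotsOfRecord₁₃_succ_le_mul_of_avgDensity_le_of_slots_le_of_liveSel (hζu : IsZetaUnity F N θ.ν θ.τ9.M θ.ζ) (hζa : IsZetaAbsLeOne F N θ.ν θ.τ9.M θ.ζ)
    (hsel : θ.ppSel = ppSelLiveOfRecord F N θ.ν θ.τ9 (EOfRecord₁₃ F N θ) (wOfRecord₉ F N θ.toStage9Params)) {D S : ℝ}
    (hD : ∀ V' : GaugeField (F.P P.K) (k + 1) (SU N), (avgDensity (avOfRecord F N P.K k).avg V' : ℝ) ≤ D) (hS0 : 0 ≤ S)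
    (hS : ∀ (s : SeqOfRecord F θ.ν θ.τ9.M (gOfRecord₁₃ F N θ P) P.K k) (U : GaugeField (F.P P.K) k (SU N)),
      slotsOfRecord F N θ.ν θ.τ9 (EOfRecord₁₃ F N θ) (wOfRecord₉ F N θ.toStage9Params) θ.ppSel P (gOfRecord₁₃ F N θ P) k s U ≤ S)
    (s' : SeqOfRecord F θ.ν θ.τ9.M (gOfRecord₁₃ F N θ P) P.K (k + 1)) (V' : GaugeField (F.P P.K) (k + 1) (SU N)) :
    slotsOfRecord F N θ.ν θ.τ9 (EOfRecord₁₃ F N θ) (wOfRecord₉ F N θ.toStage9Params) θ.ppSel P (gOfRecord₁₃ F N θ P) (k + 1) s' V' ≤ D * S :=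
  (slotsOfRecord₁₃_succ_le_slotsT_of_liveSel θ hζu hζa hsel P k s' V').trans
    (slotsTOfRecord_succ_le_mul_of_avgDensity_le_of_slots_le θ P k hζa hD hS0
      (fun s U => ⟨slotsOfRecord_nonneg F N θ.ν θ.τ9 (EOfRecord₁₃ F N θ) (wOfRecord₉_nonneg θ hζu hζa) θ.ppSel P _ k s U, hS s U⟩) s' V')

end OneStep

/-! ## §2 INDUCTION: `slot_k ≤ (∏_{j<k} D_j)·S₀` from the version bounds and the level-0 supremum -/

section Induction

variable (θ : Stage13Params F N) (P : B12.RunParams)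

/-- **★ `slot_k(s)(V) ≤ (∏_{j<k} D_j)·S₀` AT EVERY LEVEL, EVERY HISTORY, EVERY FIELD**, at a live-selector parameter with the two ζ-laws, from EVERYWHERE bounds `avgDensity_j ≤ D_j`
(`0 ≤ D_j`) on the marginal-density versions of record and the level-0 supremum `slot_0 = ρ₀ ≤ S₀` (induction on `k` through §1).
[cite: Balaban1988Convergent, Thm 1 p.262, (3.1) p.264, (3.24)–(3.25) p.270; Balaban1989LargeFieldI, (0.3) p.176, p.177 (i)–(ii) (bookkeeping)] -/
theorem slotsOfRecord₁₃_le_prod_mul_of_avgDensity_le_of_liveSel (hζu : IsZetaUnity F N θ.ν θ.τ9.M θ.ζ) (hζa : IsZetaAbsLeOne F N θ.ν θ.τ9.M θ.ζ)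
    (hsel : θ.ppSel = ppSelLiveOfRecord F N θ.ν θ.τ9 (EOfRecord₁₃ F N θ) (wOfRecord₉ F N θ.toStage9Params)) (D : ℕ → ℝ) (hD0 : ∀ j, 0 ≤ D j)
    (hD : ∀ (j : ℕ) (V' : GaugeField (F.P P.K) (j + 1) (SU N)), (avgDensity (avOfRecord F N P.K j).avg V' : ℝ) ≤ D j) {S₀ : ℝ} (hS₀ : 0 ≤ S₀)
    (h0 : ∀ (s : SeqOfRecord F θ.ν θ.τ9.M (gOfRecord₁₃ F N θ P) P.K 0) (U : GaugeField (F.P P.K) 0 (SU N)),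
      slotsOfRecord F N θ.ν θ.τ9 (EOfRecord₁₃ F N θ) (wOfRecord₉ F N θ.toStage9Params) θ.ppSel P (gOfRecord₁₃ F N θ P) 0 s U ≤ S₀) :
    ∀ (k : ℕ) (s : SeqOfRecord F θ.ν θ.τ9.M (gOfRecord₁₃ F N θ P) P.K k) (V : GaugeField (F.P P.K) k (SU N)),
      slotsOfRecord F N θ.ν θ.τ9 (EOfRecord₁₃ F N θ) (wOfRecord₉ F N θ.toStage9Params) θ.ppSel P (gOfRecord₁₃ F N θ P) k s V ≤ (∏ j ∈ Finset.range k, D j) * S₀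
  | 0, s, V => by simpa using h0 s V
  | k + 1, s, V => by
    have ih := slotsOfRecord₁₃_le_prod_mul_of_avgDensity_le_of_liveSel hζu hζa hsel D hD0 hD hS₀ h0 k
    have hP0 : 0 ≤ (∏ j ∈ Finset.range k, D j) * S₀ := mul_nonneg (Finset.prod_nonneg fun j _ => hD0 j) hS₀
    have h := slotsOfRecord₁₃_succ_le_mul_of_avgDensity_le_of_slots_le_of_liveSel θ P k hζu hζa hsel (hD k) hP0 ih s V
    calc slotsOfRecord F N θ.ν θ.τ9 (EOfRecord₁₃ F N θ) (wOfRecord₉ F N θ.toStage9Params) θ.ppSel P (gOfRecord₁₃ F N θ P) (k + 1) s V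
        ≤ D k * ((∏ j ∈ Finset.range k, D j) * S₀) := h
      _ = (∏ j ∈ Finset.range (k + 1), D j) * S₀ := by rw [Finset.prod_range_succ]; ring

end Induction

/-! ## §3 THE UPPER INEQUALITY OF (UV₁₃) WITH A LEVEL-DEPENDENT CONSTANT: `ρ_k ≤ |Seq_k|·(∏_{j<k} D_j)·S₀` -/

section Density

variable (θ : Stage13Params F N) (P : B12.RunParams)

/-- **★★ `ρ_k(V) ≤ |Seq_k|·(∏_{j<k} D_j)·S₀` AT EVERY LEVEL AND FIELD** (live-selector parameter, two ζ-laws; `0 ≤ χ_k ≤ 1`): the UPPER inequality of (UV₁₃)∕(2.50) at level `k`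
with a constant depending on the NUMBER `k` OF COMPLETED STEPS (versions' bounds, history count, level-0 supremum) — NO analytic input; print's `e₊(g_k)` is the k-UNIFORM
strengthening. [cite: Balaban1988Convergent, Cor. 3 (2.50) p.264, (2.18) p.257; Balaban1989LargeFieldII, (0.1) pp.355–356 (bookkeeping; the k-uniformity is NOT supplied)] -/
theorem densOfRecord₁₃_le_card_mul_prod_mul_of_avgDensity_le_of_liveSel (hζu : IsZetaUnity F N θ.ν θ.τ9.M θ.ζ) (hζa : IsZetaAbsLeOne F N θ.ν θ.τ9.M θ.ζ)
    (hsel : θ.ppSel = ppSelLiveOfRecord F N θ.ν θ.τ9 (EOfRecord₁₃ F N θ) (wOfRecord₉ F N θ.toStage9Params)) (D : ℕ → ℝ) (hD0 : ∀ j, 0 ≤ D j)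
    (hD : ∀ (j : ℕ) (V' : GaugeField (F.P P.K) (j + 1) (SU N)), (avgDensity (avOfRecord F N P.K j).avg V' : ℝ) ≤ D j) {S₀ : ℝ} (hS₀ : 0 ≤ S₀)
    (h0 : ∀ (s : SeqOfRecord F θ.ν θ.τ9.M (gOfRecord₁₃ F N θ P) P.K 0) (U : GaugeField (F.P P.K) 0 (SU N)),
      slotsOfRecord F N θ.ν θ.τ9 (EOfRecord₁₃ F N θ) (wOfRecord₉ F N θ.toStage9Params) θ.ppSel P (gOfRecord₁₃ F N θ P) 0 s U ≤ S₀)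
    (k : ℕ) (V : GaugeField (F.P P.K) k (SU N)) :
    densOfRecord₁₃ F N θ P k V ≤
      (Fintype.card (SeqOfRecord F θ.ν θ.τ9.M (gOfRecord₁₃ F N θ P) P.K k) : ℝ) * ((∏ j ∈ Finset.range k, D j) * S₀) := by
  have hP0 : 0 ≤ (∏ j ∈ Finset.range k, D j) * S₀ := mul_nonneg (Finset.prod_nonneg fun j _ => hD0 j) hS₀
  have hterm : ∀ s : SeqOfRecord F θ.ν θ.τ9.M (gOfRecord₁₃ F N θ P) P.K k,
      chiSeqOfRecord F N θ.ν θ.τ9.M (gOfRecord₁₃ F N θ P) P.K k s V *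
          slotsOfRecord F N θ.ν θ.τ9 (EOfRecord₁₃ F N θ) (wOfRecord₉ F N θ.toStage9Params) θ.ppSel P (gOfRecord₁₃ F N θ P) k s V ≤
        (∏ j ∈ Finset.range k, D j) * S₀ := by
    intro s
    have hχ0 : 0 ≤ chiSeqOfRecord F N θ.ν θ.τ9.M (gOfRecord₁₃ F N θ P) P.K k s V := chiSeqOfRecord_nonneg F N θ.ν θ.τ9.M _ P.K k s V
    have hχ1 : chiSeqOfRecord F N θ.ν θ.τ9.M (gOfRecord₁₃ F N θ P) P.K k s V ≤ 1 :=
      (abs_le.mp (abs_chiSeqOfRecord_le_one F N θ.ν θ.τ9.M (gOfRecord₁₃ F N θ P) P.K k s V)).2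
    have hs0 : 0 ≤ slotsOfRecord F N θ.ν θ.τ9 (EOfRecord₁₃ F N θ) (wOfRecord₉ F N θ.toStage9Params) θ.ppSel P (gOfRecord₁₃ F N θ P) k s V :=
      slotsOfRecord_nonneg F N θ.ν θ.τ9 (EOfRecord₁₃ F N θ) (wOfRecord₉_nonneg θ hζu hζa) θ.ppSel P _ k s V
    calc chiSeqOfRecord F N θ.ν θ.τ9.M (gOfRecord₁₃ F N θ P) P.K k s V *
          slotsOfRecord F N θ.ν θ.τ9 (EOfRecord₁₃ F N θ) (wOfRecord₉ F N θ.toStage9Params) θ.ppSel P (gOfRecord₁₃ F N θ P) k s V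
        ≤ 1 * ((∏ j ∈ Finset.range k, D j) * S₀) :=
          mul_le_mul hχ1 (slotsOfRecord₁₃_le_prod_mul_of_avgDensity_le_of_liveSel θ P hζu hζa hsel D hD0 hD hS₀ h0 k s V) hs0 zero_le_one
      _ = (∏ j ∈ Finset.range k, D j) * S₀ := one_mul _
  show ∑ s, _ ≤ _
  calc ∑ s, chiSeqOfRecord F N θ.ν θ.τ9.M (gOfRecord₁₃ F N θ P) P.K k s V *
          slotsOfRecord F N θ.ν θ.τ9 (EOfRecord₁₃ F N θ) (wOfRecord₉ F N θ.toStage9Params) θ.ppSel P (gOfRecord₁₃ F N θ P) k s V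
      ≤ ∑ _s : SeqOfRecord F θ.ν θ.τ9.M (gOfRecord₁₃ F N θ P) P.K k, (∏ j ∈ Finset.range k, D j) * S₀ := Finset.sum_le_sum fun s _ => hterm s
    _ = (Fintype.card (SeqOfRecord F θ.ν θ.τ9.M (gOfRecord₁₃ F N θ P) P.K k) : ℝ) * ((∏ j ∈ Finset.range k, D j) * S₀) := by
        rw [Finset.sum_const, Finset.card_univ, nsmul_eq_mul]

end Density

end Summit.QuantumFields.YangMills.BalabanUVNodes.N13UVUpperOfVersionBoundsAtLiveSelector

end
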